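import Summits.HodgeConjecture.HodgeConjecture.Theorems.F0P6bConnectedEtale   -- ★ p850126 twin of ED. 4 d2d297f26c1c1294 (re-homed, LEAD «M-72»; Theorems lane, namespace KEPT; pen LA7-plan (g4) #5)
import HarnessLib

/-! # F0_P6b_ConnectedEtale — ED. 5 = SHIM (re-home).  Every declaration of the connected–étale organ line now lives, under the SAME fully-qualified names
(namespace `Summit.HodgeConjecture.HodgeConjecture.Cruxes.HLiu418.F0P6bConnectedEtale` kept), in ★ `Theorems/F0P6bConnectedEtale.lean` (p850126; tree bytes of
ED. 4 d2d297f26c1c1294 re-headed); this file only imports it, so the module `…Cruxes.HLiu418.Lines.F0_P6b_ConnectedEtale` keeps serving the names to any importer (tree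
importers today: none).  The ONE name the ★ twin does not restate (`stub_b1d_reductionSurjective`, dropped there under `dedup.landed` because it IS ★ p844835
`F0P6bConnectedEtaleStubB1d.stub_b1d_reductionSurjective_holds`) is kept alive here BY NAME with its ED. 2–4 statement byte-identical, `:=` the ★ declaration —
so no fully-qualified name of ED. 4 disappears.  HC_CM is proved only modulo the 7 printed citations (2 remaining named inputs) until rung 0 closes; count-neutral
(0 `sorry`, 0 socket; the one theorem below is an alias by proof term). -/

noncomputable section

set_option autoImplicit false
set_option linter.dupNamespace false  -- `Summit.HodgeConjecture.HodgeConjecture.…` BY DESIGN (D-0017)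

open CategoryTheory CategoryTheory.Limits AlgebraicGeometry MonoidalCategory CartesianMonoidalCategory IsLocalRing
open scoped MonObj

namespace Summit.HodgeConjecture.HodgeConjecture.Cruxes.HLiu418.F0P6bConnectedEtale

/-- **PAID (ED. 2) `stub_b1d_reductionSurjective` := ★ p844835 `F0P6bConnectedEtaleStubB1d.stub_b1d_reductionSurjective_holds` (F0P6-p11 (g0)).** (S) — (M-1a (3) (b1-iii), surjectivity half) base `V ⊆ Ω` the valuation ring of an
ALGEBRAICALLY CLOSED field, `G` finite FLAT over `Spec V`: every `κ(V)`-point of `G` over `Spec V` is the reduction of a section.  Route: the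
local factor `B_𝔫` at the `κ(V)`-point is finite flat local over `V`, so `Ω ⊗_V B_𝔫 ≠ 0` has an `Ω`-point (`Ω` algebraically closed), which is
integral over `V`, hence a `V`-point of `B_𝔫` (★ `Valuation/AlgHomIntoValuationSubring`), whose reduction is `𝔫`; or directly ★
`Valuation/IntegralPointsSpecialisationCount.card_algHom_residue_comp_eq` (number of sections with given reduction `=` rank of the corner `≥ 1`).
With `stub_b1b` this gives M-1a (b1-iii) «`G(Ω) = G(V) → G(κ̄)` surjective with kernel `G⁰(Ω)`».  Why it might fail as typed: FALSE without
flatness (`G = Spec κ`, a `κ`-point with no section) and FALSE over a DVR with algebraically closed residue field but non-closed fraction field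
(ordinary `E[p]` over `W(κ̄)` with Serre–Tate parameter `∉ (W^×)^p`: the non-trivial `κ̄`-points do not lift) — hence `V ⊆ Ω = Ω̄`.
[cite: SerreTate1968, §1 Lemma 1] [cite: Tate1997FiniteFlatGroupSchemes, (3.7)] -/
theorem stub_b1d_reductionSurjective :
    ∀ (Ω : Type) [Field Ω] [IsAlgClosed Ω] (V : ValuationSubring Ω) (G : Over (Spec (.of V))),
      IsFinite G.hom → Flat G.hom →
        ∀ t₀ : Spec (.of (ResidueField V)) ⟶ G.left, t₀ ≫ G.hom = Spec.map (CommRingCat.ofHom (residue V)) →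
          ∃ s : 𝟙_ (Over (Spec (.of V))) ⟶ G, Spec.map (CommRingCat.ofHom (residue V)) ≫ s.left = t₀ :=
  -- ED. 2: PAID BY NAME (statement UNCHANGED) — ★ p844835 `Theorems/F0P6bConnectedEtaleStubB1d` (F0P6-p11 (g0); twin-checked F0P6-p16 (g0)).
  F0P6bConnectedEtaleStubB1d.stub_b1d_reductionSurjective_holds

end Summit.HodgeConjecture.HodgeConjecture.Cruxes.HLiu418.F0P6bConnectedEtale

end
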